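import Literature.MathematicalPhysics.QuantumFieldTheory.Balaban1983to89.B4TorusGreen244
import Literature.MathematicalPhysics.QuantumFieldTheory.Balaban1983to89.B4Green242Bridge
import HarnessLib

/-!
# BalabanUVNodes ∕ N15 — THE KING-MODEL RUNG (PART Ε-a): THE FREE MASSIVE RESOLVENT KERNEL OF `c(−Δ) + m²` ON THE INFINITE LATTICE `ℤ^{d+1}` —
# `K_∞(z) = (2π)^{−(d+1)} ∫_{[−π,π]^{d+1}} e^{ip·z} ∕ (m² + cΣ_μ(2 − 2cos p_μ)) dp`: STRIP REGULARITY of the multiplier (explicit half-width), EXPONENTIAL DECAY,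
# THE GREEN EQUATION `m²K_∞(z) + cΣ_μ(2K_∞(z) − K_∞(z+e_μ) − K_∞(z−e_μ)) = δ_{z,0}` on the whole lattice, `K_∞` REAL and EVEN, `K_∞ ∈ ℓ¹`
# (Track A, DAG node N15 = NE2; FAN-OUT v1.1 §N15 s3 «KING-MODEL RUNG»; the infinite-volume partner of King's torus covariance `(lapF K c m²)⁻¹`; count-neutral)

HONEST FRAMING.  Count-neutral (cell `pub-ymgap`, seat `pub-ymgap-dag-n15-e` g40; `--supports stmt-QuantumFields-27366 --as helper` = K3⁸).
TEMPLATE LITERATURE: C. King, Commun. Math. Phys. **102** (1986) 649–677 [King1986], §4 p.670 l.8–13: «By using multiple reflection representations, the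
propagators G^η_k and G^η_k(Ω) can be written in terms of the operator defined by (2.13) with free boundary conditions (and A = 0, of course), as long as Ω is
a rectangular parallelepiped which is a union of blocks of L^k sites. Such representations are given explicitly in [Ba 4], so it is sufficient to prove
Propositions 3.8 and 3.9 for the operator with free boundary conditions»; [Ba 4] = T. Bałaban, Commun. Math. Phys. **89** (1983) 571–597
[Balaban1983RegularityDecay], (2.42) p.584 (the image series over the reflection group of the box, each term «the propagator G_j with free boundary conditions on
ξZ^d»), (2.43) p.584 (the Fourier transform on the infinite lattice).  The operator «with free boundary conditions» on the INFINITE lattice `ℤ^{d+1}` is the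
translation-invariant `c(−Δ) + m²` (King's (4.4) symbol `m² + cΣ_μ(2 − 2cos p_μ)`, `c = η⁻²` in unit-lattice variables); its kernel is the lattice Fourier
integral above — the object [Ba 4] (2.42) sums over images.  Parts Ν (g39) of this lineage wrote King's box covariance as a FINITE image sum over the
DOUBLED TORUS (a periodized form); this part Ε supplies the infinite-lattice kernel itself (Ε-a), identifies King's torus covariance with its periodisation
(Ε-b) and the doubled-torus image sum with [Ba 4]'s infinite image series (Ε-c).

THIS FILE (Ε-a) is the `ℤ^{d+1}` kernel, built on the cell's contour-shift engine `B4ContourShift` (pv17: `latticeKernel`, `StripRegular`,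
`latticeKernel_decay`, `stripRegular_inv`) and lattice-kernel calculus `B4Green244` (b04: `latticeKernel_phase_mul`, `latticeKernel_one`, `latticeKernel_sum_mul`):
§1 the SYMBOL `freeSymC c m² p = m² + cΣ_μ S1(p_μ)` (`S1 z = 2 − 2cos z`) on complex momenta and the MULTIPLIER `freeMultC = freeSymC⁻¹`: entire, `2π`-periodic,
real `≥ m²` on the real zone (`freeSymC_ofRealVec`); §2 ON THE STRIP `|Im p_μ| ≤ κ ≤ 1`: `Re S1(z) ≥ −(25∕16)(Im z)²` (`B4StripCauchy.re_Sxi_ge` at `n = 1`), hence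
`Re freeSymC ≥ m² − (25∕16)c(d+1)κ²` (`re_freeSymC_ge`); with the EXPLICIT HALF-WIDTH `kappaFree c m² d = min 1 √(m²∕(4(c+1)(d+1)))` (`kappaFree_pos`) this is `≥ m²∕2`, so
★★ **`stripRegular_freeMultC`**: `StripRegular freeMultC (kappaFree c m² d) (2∕m²)` for every `c ≥ 0`, `m² > 0`; §3 the KERNEL `freeKerC c m² z := latticeKernel freeMultC z`
and ★★ **`norm_freeKerC_le`**: `‖K_∞(z)‖ ≤ (2∕m²)·e^{−κ_F|z|_∞}`; `summable_freeKerC` (`K_∞ ∈ ℓ¹`); §4 ★★★ **`freeKerC_green`**: THE GREEN EQUATION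
`m²K_∞(z) + cΣ_μ(2K_∞(z) − K_∞(z+e_μ) − K_∞(z−e_μ)) = δ_{z,0}` for ALL `z ∈ ℤ^{d+1}` (the multiplier times the symbol is `1` on the real zone; phases translate the
kernel); §5 `conj K_∞(z) = K_∞(−z)` (the multiplier is real on the real zone), `K_∞(−z) = K_∞(z)` (the zone and the symbol are even; `integral_neg_eq_self`), hence
★ `freeKerC_im` (`K_∞` is REAL), the real kernel `freeKer := Re K_∞` with `ofReal_freeKer`, ★★ `freeKer_green`, ★★ `abs_freeKer_le`, `freeKer_neg`, `summable_freeKer`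
(the phase bookkeeping `phase p (−z) = −phase p z` etc. is inlined; cf. `BalabanUV.Beta.GAN24.DirichletExhaustionDeltaZSymm.latticeKernel_neg` for a kin identity).

PRIOR TREE ART (used, not restated): `B5G183FreeDecay.freeMult n N` is the UNIT-MASS multiplier with Laplacian coefficient `n²`, `n ∈ ℕ` — not the general `(c, m²)` of
King's `lapF K c m²`; `B4Green244.K`∕`B4StripSums.G` is [Ba 4]'s (2.48) kernel of `−Δ^ξ + m² + aQ^*Q`, `a > 0` (the `a ≠ 0` analogue).  Every declaration here is folklore
(the massive free lattice propagator), tagged with King's∕[Ba 4]'s locators for the dictionary.  NOT Bałaban's covariant `G_k(Ω, A)`; NOT a node discharge (N15 is booked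
through n15-a's knit, untouched); nothing continuum-YM ∕ `ℝ⁴` ∕ OS ∕ Clay.  0 `sorry`; 5 `def` (`freeSymC`, `kappaFree`, `freeMultC`, `freeKerC`, `freeKer`).
HONEST SCOPE.  `c ≥ 0`, `m² > 0`, any `d`; `κ_F` and `2∕m²` are crude (true rate `≈ arcosh(1 + m²∕2c)`); only positivity∕explicitness matter downstream (absolute
convergence of the periodisation and image series).  Locators: [King1986] (2.13) p.653, (4.4) p.670, §4 p.670 l.8–13; [Balaban1983RegularityDecay] (2.42)–(2.43) p.584.
-/

noncomputable section

open scoped BigOperators ComplexConjugate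
open Finset Complex MeasureTheory

namespace Summit.QuantumFields.YangMills.BalabanUVNodes.N15KingModelRung.TorusSpectral

open Literature.MathematicalPhysics.QuantumFieldTheory.Balaban1983to89.B4Strip (S1 S1r Strip ofRealVec S1_ofReal S1r_nonneg)
open Literature.MathematicalPhysics.QuantumFieldTheory.Balaban1983to89.B4StripCauchy (re_Sxi_ge S1_eq_Sxi_one)
open Literature.MathematicalPhysics.QuantumFieldTheory.Balaban1983to89.B4ContourShift
open Literature.MathematicalPhysics.QuantumFieldTheory.Balaban1983to89.B4Green244 (e phaseC phaseC_ofRealVec two_sub_exp latticeKernel_phase_mul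
  latticeKernel_one latticeKernel_congr latticeKernel_sum_mul)
open Literature.MathematicalPhysics.QuantumFieldTheory.Balaban1983to89.B5Strip145Analytic (S1_add_two_pi)
open Literature.MathematicalPhysics.QuantumFieldTheory.Balaban1983to89.B5Strip145Decay (differentiableAt_insertNth)
open Literature.MathematicalPhysics.QuantumFieldTheory.Balaban1983to89.B4Green242Bridge (latticeKernel_sub latticeKernel_const_mul)
open Literature.MathematicalPhysics.QuantumFieldTheory.Balaban1983to89.B4TorusKernel (summable_of_decay supNorm_neg)

variable {d : ℕ}

/-! ## §1 The symbol `m² + cΣ_μ(2 − 2cos p_μ)` on complex momenta and the multiplier `1∕(m² + cΣ_μ(2 − 2cos p_μ))` -/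

/-- THE SYMBOL of `c(−Δ) + m²` continued to complex momenta: `m² + c·Σ_μ (2 − 2cos p_μ)` (King's (4.4) `Δ^η(p) + m²` in unit-lattice variables, `c = η⁻²`).
[cite: King1986, (4.4) p.670; Balaban1983RegularityDecay, (2.43) p.584] -/
def freeSymC (c m2 : ℝ) (p : Fin (d + 1) → ℂ) : ℂ := (m2 : ℂ) + (c : ℂ) * ∑ μ, S1 (p μ)

/-- THE FOURIER MULTIPLIER of the free massive resolvent: `1∕(m² + cΣ_μ(2 − 2cos p_μ))`. [cite: King1986, (4.4) p.670; Balaban1983RegularityDecay, (2.43) p.584] -/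
def freeMultC (c m2 : ℝ) (p : Fin (d + 1) → ℂ) : ℂ := (freeSymC c m2 p)⁻¹

/-- On the real zone the symbol is the real number `m² + cΣ_μ(2 − 2cos p_μ)`. [cite: King1986, (4.4) p.670] -/
theorem freeSymC_ofRealVec (c m2 : ℝ) (p : Fin (d + 1) → ℝ) :
    freeSymC c m2 (ofRealVec p) = (((m2 + c * ∑ μ, S1r (p μ)) : ℝ) : ℂ) := by
  unfold freeSymC; push_cast; congr 1; congr 1
  exact Finset.sum_congr rfl fun μ _ => by rw [show ofRealVec p μ = ((p μ : ℝ) : ℂ) from rfl, S1_ofReal]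

/-- On the real zone the symbol is at least `m²` (`c ≥ 0`). [cite: King1986, (4.4) p.670] -/
theorem le_freeSymR (c m2 : ℝ) (hc : 0 ≤ c) (p : Fin (d + 1) → ℝ) : m2 ≤ m2 + c * ∑ μ, S1r (p μ) :=
  le_add_of_nonneg_right (mul_nonneg hc (Finset.sum_nonneg fun _ _ => S1r_nonneg _))

/-- The symbol does not vanish on the real zone (`c ≥ 0`, `m² > 0`). [folklore] -/
theorem freeSymC_ofRealVec_ne_zero {c m2 : ℝ} (hc : 0 ≤ c) (hm : 0 < m2) (p : Fin (d + 1) → ℝ) : freeSymC c m2 (ofRealVec p) ≠ 0 := by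
  rw [freeSymC_ofRealVec]
  exact_mod_cast (lt_of_lt_of_le hm (le_freeSymR c m2 hc p)).ne'

/-- On the real zone the multiplier is the real number `1∕(m² + cΣ_μ(2 − 2cos p_μ))`. [cite: King1986, (4.4) p.670] -/
theorem freeMultC_ofRealVec (c m2 : ℝ) (p : Fin (d + 1) → ℝ) :
    freeMultC c m2 (ofRealVec p) = (((m2 + c * ∑ μ, S1r (p μ))⁻¹ : ℝ) : ℂ) := by
  rw [freeMultC, freeSymC_ofRealVec, Complex.ofReal_inv]

/-- The symbol is an entire function of the `d+1` complex momenta. [folklore] -/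
theorem differentiable_freeSymC (c m2 : ℝ) : Differentiable ℂ (freeSymC (d := d) c m2) := by
  unfold freeSymC S1
  fun_prop

/-- The symbol is `2π`-periodic in every coordinate. [folklore] -/
theorem freeSymC_periodic (c m2 : ℝ) (i : Fin (d + 1)) (p : Fin (d + 1) → ℂ) :
    freeSymC c m2 (Function.update p i (p i + 2 * Real.pi)) = freeSymC c m2 p := by
  unfold freeSymC; congr 2
  refine Finset.sum_congr rfl fun μ _ => ?_
  by_cases h : μ = i
  · subst h; rw [Function.update_self, S1_add_two_pi]
  · rw [Function.update_of_ne h]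

/-! ## §2 Strip regularity of the multiplier, with an explicit half-width -/

/-- `Re (2 − 2cos z) ≥ −(25∕16)(Im z)²` for `|Im z| ≤ 1` (`B4StripCauchy.re_Sxi_ge` at `n = 1`, dropping the `4sin²` term). [folklore] -/
theorem re_S1_ge (z : ℂ) (hz : |z.im| ≤ 1) : -(25 / 16 * z.im ^ 2) ≤ (S1 z).re := by
  have h := re_Sxi_ge 1 le_rfl z hz
  rw [← S1_eq_Sxi_one] at h
  have h0 : 0 ≤ 4 * ((1 : ℕ) : ℝ) ^ 2 * Real.sin (z.re / (2 * ((1 : ℕ) : ℝ))) ^ 2 := by positivity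
  linarith

/-- ON THE STRIP `|Im p_μ| ≤ κ ≤ 1`: `Re(m² + cΣ_μ S1(p_μ)) ≥ m² − (25∕16)·c·(d+1)·κ²` (`c ≥ 0`). [folklore] -/
theorem re_freeSymC_ge {c : ℝ} (m2 : ℝ) (hc : 0 ≤ c) {κ : ℝ} (hκ1 : κ ≤ 1) {p : Fin (d + 1) → ℂ} (hp : p ∈ Strip (d + 1) κ) :
    m2 - 25 / 16 * c * (d + 1) * κ ^ 2 ≤ (freeSymC c m2 p).re := by
  unfold freeSymC
  rw [Complex.add_re, Complex.ofReal_re, Complex.re_ofReal_mul, Complex.re_sum]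
  have hμ : ∀ μ, -(25 / 16 * κ ^ 2) ≤ (S1 (p μ)).re := fun μ => by
    have h1 : |(p μ).im| ≤ κ := (hp μ).2
    have h2 := re_S1_ge (p μ) (h1.trans hκ1)
    have h3 : (p μ).im ^ 2 ≤ κ ^ 2 := by rw [← sq_abs]; exact pow_le_pow_left₀ (abs_nonneg _) h1 2
    nlinarith
  have hsum : -(25 / 16 * κ ^ 2) * (d + 1) ≤ ∑ μ : Fin (d + 1), (S1 (p μ)).re := by
    have := Finset.sum_le_sum fun μ (_ : μ ∈ (Finset.univ : Finset (Fin (d + 1)))) => hμ μ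
    rw [Finset.sum_const, Finset.card_univ, Fintype.card_fin, nsmul_eq_mul] at this
    push_cast at this
    linarith
  have key : c * (-(25 / 16 * κ ^ 2) * (d + 1)) ≤ c * ∑ μ : Fin (d + 1), (S1 (p μ)).re := mul_le_mul_of_nonneg_left hsum hc
  have e : c * (-(25 / 16 * κ ^ 2) * ((d : ℝ) + 1)) = -(25 / 16 * c * (d + 1) * κ ^ 2) := by ring
  linarith

/-- THE EXPLICIT HALF-WIDTH `κ_F(c, m², d) = min 1 √(m²∕(4(c+1)(d+1)))`. [folklore] -/
def kappaFree (c m2 : ℝ) (d : ℕ) : ℝ := min 1 (Real.sqrt (m2 / (4 * (c + 1) * (d + 1))))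

/-- `κ_F > 0` (`c ≥ 0`, `m² > 0`). [folklore] -/
theorem kappaFree_pos {c m2 : ℝ} (hc : 0 ≤ c) (hm : 0 < m2) (d : ℕ) : 0 < kappaFree c m2 d :=
  lt_min one_pos (Real.sqrt_pos.mpr (by positivity))

/-- the defining inequality of the half-width: `(25∕16)·c·(d+1)·κ_F² ≤ m²∕2`. [folklore] -/
theorem kappaFree_sq_bound {c m2 : ℝ} (hc : 0 ≤ c) (hm : 0 < m2) (d : ℕ) : 25 / 16 * c * (d + 1) * kappaFree c m2 d ^ 2 ≤ m2 / 2 := by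
  have hD : (0 : ℝ) < 4 * (c + 1) * (d + 1) := by positivity
  have h1 : kappaFree c m2 d ^ 2 ≤ m2 / (4 * (c + 1) * (d + 1)) := by
    have hk0 : 0 ≤ kappaFree c m2 d := (kappaFree_pos hc hm d).le
    have hle : kappaFree c m2 d ≤ Real.sqrt (m2 / (4 * (c + 1) * (d + 1))) := min_le_right _ _
    calc kappaFree c m2 d ^ 2 ≤ Real.sqrt (m2 / (4 * (c + 1) * (d + 1))) ^ 2 := pow_le_pow_left₀ hk0 hle 2
      _ = m2 / (4 * (c + 1) * (d + 1)) := Real.sq_sqrt (by positivity)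
  have h2 : 25 / 16 * c * (d + 1) * (m2 / (4 * (c + 1) * (d + 1))) = 25 / 64 * (c / (c + 1)) * m2 := by
    field_simp
    ring
  have h3 : c / (c + 1) ≤ 1 := (div_le_one (by linarith)).mpr (by linarith)
  have h4 : 25 / 16 * c * (d + 1) * kappaFree c m2 d ^ 2 ≤ 25 / 16 * c * (d + 1) * (m2 / (4 * (c + 1) * (d + 1))) :=
    mul_le_mul_of_nonneg_left h1 (by positivity)
  nlinarith

/-- LOWER BOUND ON THE STRIP: `‖m² + cΣ_μ S1(p_μ)‖ ≥ m²∕2` for `|Im p_μ| ≤ κ_F`. [folklore] -/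
theorem norm_freeSymC_ge {c m2 : ℝ} (hc : 0 ≤ c) (hm : 0 < m2) {p : Fin (d + 1) → ℂ} (hp : p ∈ Strip (d + 1) (kappaFree c m2 d)) :
    m2 / 2 ≤ ‖freeSymC c m2 p‖ := by
  have hk1 : kappaFree c m2 d ≤ 1 := min_le_left _ _
  have h1 := re_freeSymC_ge m2 hc hk1 hp
  have h2 := kappaFree_sq_bound hc hm d
  exact le_trans (by linarith) (Complex.re_le_norm _)

/-- ★★ **STRIP REGULARITY OF THE FREE MULTIPLIER**: for every `c ≥ 0`, `m² > 0`, `1∕(m² + cΣ_μ(2 − 2cos p_μ))` is continuous on the closed strip of half-width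
`κ_F(c,m²,d)` around `[−π,π]^{d+1}`, holomorphic in every coordinate slice, `2π`-periodic, and bounded by `2∕m²` there — the hypotheses of the cell's contour-shift
engine `B4ContourShift`. [cite: Balaban1983RegularityDecay, (2.43) p.584, p.586 l.9–15 (the contour shift); King1986, (4.4) p.670] -/
theorem stripRegular_freeMultC {c m2 : ℝ} (hc : 0 ≤ c) (hm : 0 < m2) : StripRegular (freeMultC (d := d) c m2) (kappaFree c m2 d) (2 / m2) := by
  have hκ0 : 0 ≤ kappaFree c m2 d := (kappaFree_pos hc hm d).le
  have hdiff := differentiable_freeSymC (d := d) c m2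
  have h := stripRegular_inv (F := freeSymC (d := d) c m2) hκ0 (half_pos hm) hdiff.continuous.continuousOn
    (fun i q _ => (hdiff.comp fun z => differentiableAt_insertNth i (ofRealVec q) z).differentiableOn)
    (fun i q _ y _ => sides_of_periodic (freeSymC c m2) (fun j p => freeSymC_periodic c m2 j p) i q y)
    (fun p hp => norm_freeSymC_ge hc hm hp)
  have hb : (m2 / 2)⁻¹ = 2 / m2 := by rw [inv_div]
  rw [hb] at h
  exact h

/-! ## §3 The kernel `K_∞` and its exponential decay -/

/-- THE FREE MASSIVE RESOLVENT KERNEL ON `ℤ^{d+1}` (complex form): `K_∞(z) = (2π)^{−(d+1)}∫_{[−π,π]^{d+1}} e^{ip·z}∕(m² + cΣ_μ(2−2cos p_μ)) dp` — the kernel of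
«the operator defined by (2.13) with free boundary conditions (and A = 0, of course)» on the infinite lattice, the object [Ba 4] (2.42) sums over images.
[cite: King1986, §4 p.670 l.8–13, (2.13) p.653; Balaban1983RegularityDecay, (2.42)–(2.43) p.584] -/
def freeKerC (c m2 : ℝ) (z : Fin (d + 1) → ℤ) : ℂ := latticeKernel (freeMultC c m2) z

/-- ★★ **EXPONENTIAL DECAY**: `‖K_∞(z)‖ ≤ (2∕m²)·e^{−κ_F|z|_∞}` for every `z ∈ ℤ^{d+1}` (`c ≥ 0`, `m² > 0`), by the contour shift. [cite: Balaban1983RegularityDecay,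
p.586 l.9–15; King1986, (4.4) p.670] -/
theorem norm_freeKerC_le {c m2 : ℝ} (hc : 0 ≤ c) (hm : 0 < m2) (z : Fin (d + 1) → ℤ) :
    ‖freeKerC c m2 z‖ ≤ 2 / m2 * Real.exp (-(kappaFree c m2 d * supNorm z)) :=
  latticeKernel_decay (stripRegular_freeMultC hc hm) ((kappaFree_pos hc hm d).le) z

/-- `K_∞ ∈ ℓ¹(ℤ^{d+1})`. [folklore] -/
theorem summable_freeKerC {c m2 : ℝ} (hc : 0 ≤ c) (hm : 0 < m2) : Summable (freeKerC (d := d) c m2) :=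
  summable_of_decay _ (kappaFree_pos hc hm d) (norm_freeKerC_le hc hm)

/-- `‖K_∞‖ ∈ ℓ¹(ℤ^{d+1})`. [folklore] -/
theorem summable_norm_freeKerC {c m2 : ℝ} (hc : 0 ≤ c) (hm : 0 < m2) : Summable (fun z : Fin (d + 1) → ℤ => ‖freeKerC c m2 z‖) := by
  have h := summable_of_decay (fun z : Fin (d + 1) → ℤ => ((‖freeKerC c m2 z‖ : ℝ) : ℂ)) (kappaFree_pos hc hm d)
    (fun z => by rw [Complex.norm_real, Real.norm_eq_abs, abs_norm]; exact norm_freeKerC_le hc hm z)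
  exact (Complex.summable_ofReal).mp h

/-! ## §4 The Green equation on the whole lattice -/

/-- `p·e_μ = p_μ`. [folklore] -/
theorem phaseC_e (P : Fin (d + 1) → ℂ) (μ : Fin (d + 1)) : phaseC P (e μ) = P μ := by
  unfold phaseC e
  rw [Finset.sum_eq_single μ (fun ν _ hν => by rw [Pi.single_eq_of_ne hν]; simp) (fun h => absurd (Finset.mem_univ μ) h)]
  simp

/-- `p·(−e_μ) = −p_μ`. [folklore] -/
theorem phaseC_neg_e (P : Fin (d + 1) → ℂ) (μ : Fin (d + 1)) : phaseC P (-e μ) = -P μ := by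
  rw [← phaseC_e P μ]; unfold phaseC; rw [← Finset.sum_neg_distrib]
  exact Finset.sum_congr rfl fun ν _ => by rw [Pi.neg_apply, Int.cast_neg, mul_neg]

/-- The multiplier is holomorphic at every real momentum. [folklore] -/
theorem differentiableAt_freeMultC {c m2 : ℝ} (hc : 0 ≤ c) (hm : 0 < m2) (p : Fin (d + 1) → ℝ) :
    DifferentiableAt ℂ (freeMultC (d := d) c m2) (ofRealVec p) :=
  ((differentiable_freeSymC c m2).differentiableAt).inv (freeSymC_ofRealVec_ne_zero hc hm p)

/-- linearity of the lattice kernel: sums (zone-integrable multipliers). [folklore] -/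
theorem latticeKernel_add' {G₁ G₂ : (Fin (d + 1) → ℂ) → ℂ} (x : Fin (d + 1) → ℤ)
    (h₁ : IntegrableOn (integrand G₁ x) (BZ (d + 1))) (h₂ : IntegrableOn (integrand G₂ x) (BZ (d + 1))) :
    latticeKernel (fun P => G₁ P + G₂ P) x = latticeKernel G₁ x + latticeKernel G₂ x := by
  unfold latticeKernel fourierBox
  have h : integrand (fun P => G₁ P + G₂ P) x = fun p => integrand G₁ x p + integrand G₂ x p := by
    funext p; unfold integrand; ring
  rw [h, integral_add h₁ h₂, smul_add]

/-- ★★★ **THE GREEN EQUATION ON THE WHOLE LATTICE**: for every `c ≥ 0`, `m² > 0` and every `z ∈ ℤ^{d+1}`,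
`m²·K_∞(z) + c·Σ_μ (2K_∞(z) − K_∞(z + e_μ) − K_∞(z − e_μ)) = δ_{z,0}` — `K_∞` is the kernel of `(c(−Δ) + m²)⁻¹` on `ℓ²(ℤ^{d+1})`: a phase `e^{±ip_μ}` in the
multiplier translates the kernel by `±e_μ`, the multiplier times the symbol is `1` on the real zone, and the kernel of `1` is `δ`. [cite: King1986, (2.13) p.653,
§4 p.670 l.8–13; Balaban1983RegularityDecay, (2.43)–(2.44) p.584] -/
theorem freeKerC_green {c m2 : ℝ} (hc : 0 ≤ c) (hm : 0 < m2) (z : Fin (d + 1) → ℤ) :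
    (m2 : ℂ) * freeKerC c m2 z + (c : ℂ) * ∑ μ, (2 * freeKerC c m2 z - freeKerC c m2 (z + e μ) - freeKerC c m2 (z - e μ))
      = if z = 0 then 1 else 0 := by
  set G := freeMultC (d := d) c m2 with hG
  have hGd : ∀ p : Fin (d + 1) → ℝ, DifferentiableAt ℂ G (ofRealVec p) := differentiableAt_freeMultC hc hm
  -- integrability on the zone of every multiplier that occurs (all holomorphic at the real points)
  have hI : ∀ {F : (Fin (d + 1) → ℂ) → ℂ}, (∀ p : Fin (d + 1) → ℝ, DifferentiableAt ℂ F (ofRealVec p)) →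
      IntegrableOn (integrand F z) (BZ (d + 1)) := fun hF =>
    Literature.MathematicalPhysics.QuantumFieldTheory.Balaban1983to89.B4Green244.integrableOn_of_differentiableAt (fun p _ => hF p) z
  have hφ : ∀ (s : Fin (d + 1) → ℤ) (p : Fin (d + 1) → ℝ),
      DifferentiableAt ℂ (fun P : Fin (d + 1) → ℂ => cexp (I * phaseC P s)) (ofRealVec p) := by
    intro s p; unfold phaseC; fun_prop
  have hS : ∀ (μ : Fin (d + 1)) (p : Fin (d + 1) → ℝ), DifferentiableAt ℂ (fun P : Fin (d + 1) → ℂ => S1 (P μ)) (ofRealVec p) := by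
    intro μ p; unfold S1; fun_prop
  have hsumD : ∀ p : Fin (d + 1) → ℝ, DifferentiableAt ℂ (fun P : Fin (d + 1) → ℂ => ∑ μ, S1 (P μ) * G P) (ofRealVec p) := fun p => by
    have h := DifferentiableAt.sum (u := Finset.univ) (A := fun μ P => S1 (P μ) * G P) fun μ _ => (hS μ p).mul (hGd p)
    simpa only [Finset.sum_fn] using h
  -- the shifted kernels are kernels of phase-multiplied multipliers
  have hplus : ∀ μ, freeKerC c m2 (z + e μ) = latticeKernel (fun P => cexp (I * phaseC P (e μ)) * G P) z := fun μ => by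
    rw [latticeKernel_phase_mul]; rfl
  have hminus : ∀ μ, freeKerC c m2 (z - e μ) = latticeKernel (fun P => cexp (I * phaseC P (-e μ)) * G P) z := fun μ => by
    rw [latticeKernel_phase_mul, ← sub_eq_add_neg]; rfl
  have hK : freeKerC c m2 z = latticeKernel G z := rfl
  -- one direction: `2K(z) − K(z+e_μ) − K(z−e_μ)` is the kernel of `S1(p_μ)·G`
  have hdir : ∀ μ, 2 * freeKerC c m2 z - freeKerC c m2 (z + e μ) - freeKerC c m2 (z - e μ) = latticeKernel (fun P => S1 (P μ) * G P) z := by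
    intro μ
    have e1 : (fun P => S1 (P μ) * G P) = fun P => (2 * G P - cexp (I * phaseC P (e μ)) * G P) - cexp (I * phaseC P (-e μ)) * G P := by
      funext P
      rw [← two_sub_exp (P μ), phaseC_e, phaseC_neg_e, show I * -P μ = -(I * P μ) by ring]
      ring
    have i1 : IntegrableOn (integrand (fun P => 2 * G P - cexp (I * phaseC P (e μ)) * G P) z) (BZ (d + 1)) :=
      hI (F := fun P => 2 * G P - cexp (I * phaseC P (e μ)) * G P) fun p => ((differentiableAt_const _).mul (hGd p)).sub ((hφ _ p).mul (hGd p))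
    have i2 : IntegrableOn (integrand (fun P => cexp (I * phaseC P (-e μ)) * G P) z) (BZ (d + 1)) :=
      hI (F := fun P => cexp (I * phaseC P (-e μ)) * G P) fun p => (hφ _ p).mul (hGd p)
    have i3 : IntegrableOn (integrand (fun P => 2 * G P) z) (BZ (d + 1)) :=
      hI (F := fun P => 2 * G P) fun p => (differentiableAt_const _).mul (hGd p)
    have i4 : IntegrableOn (integrand (fun P => cexp (I * phaseC P (e μ)) * G P) z) (BZ (d + 1)) :=
      hI (F := fun P => cexp (I * phaseC P (e μ)) * G P) fun p => (hφ _ p).mul (hGd p)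
    rw [e1, latticeKernel_sub z i1 i2, latticeKernel_sub z i3 i4, latticeKernel_const_mul, hK, hplus, hminus]
  -- all directions
  have hsum : ∑ μ, (2 * freeKerC c m2 z - freeKerC c m2 (z + e μ) - freeKerC c m2 (z - e μ))
      = latticeKernel (fun P => ∑ μ, S1 (P μ) * G P) z := by
    have h := latticeKernel_sum_mul Finset.univ (fun _ => (1 : ℂ)) (fun μ P => S1 (P μ) * G P) z
      (fun μ _ => hI fun p => (hS μ p).mul (hGd p))
    simp only [one_mul] at h
    rw [h]
    exact Finset.sum_congr rfl fun μ _ => hdir μ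
  -- assemble: the multiplier of the left side is `(m² + cΣ_μ S1(p_μ))·G = 1` on the real zone
  have j1 : IntegrableOn (integrand (fun P => (m2 : ℂ) * G P) z) (BZ (d + 1)) :=
    hI (F := fun P => (m2 : ℂ) * G P) fun p => (differentiableAt_const _).mul (hGd p)
  have j2 : IntegrableOn (integrand (fun P => (c : ℂ) * ∑ μ, S1 (P μ) * G P) z) (BZ (d + 1)) :=
    hI (F := fun P => (c : ℂ) * ∑ μ, S1 (P μ) * G P) fun p => (differentiableAt_const _).mul (hsumD p)
  rw [hsum, hK, ← latticeKernel_const_mul (m2 : ℂ) G z, ← latticeKernel_const_mul (c : ℂ) (fun P => ∑ μ, S1 (P μ) * G P) z,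
    ← latticeKernel_add' z j1 j2, ← latticeKernel_one z]
  refine latticeKernel_congr (fun p _ => ?_) z
  show (m2 : ℂ) * G (ofRealVec p) + (c : ℂ) * ∑ μ, S1 (ofRealVec p μ) * G (ofRealVec p) = 1
  rw [← Finset.sum_mul, ← mul_assoc, ← add_mul]
  exact mul_inv_cancel₀ (freeSymC_ofRealVec_ne_zero hc hm p)

/-! ## §5 `K_∞` is real and even; the real kernel -/

/-- The multiplier is real on the real zone: `conj G(p) = G(p)`. [folklore] -/
theorem conj_freeMultC_ofRealVec (c m2 : ℝ) (p : Fin (d + 1) → ℝ) : conj (freeMultC c m2 (ofRealVec p)) = freeMultC c m2 (ofRealVec p) := by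
  rw [freeMultC_ofRealVec, Complex.conj_ofReal]

/-- The multiplier is even on the real zone: `G(−p) = G(p)`. [folklore] -/
theorem freeMultC_ofRealVec_neg (c m2 : ℝ) (p : Fin (d + 1) → ℝ) : freeMultC c m2 (ofRealVec (-p)) = freeMultC c m2 (ofRealVec p) := by
  rw [freeMultC_ofRealVec, freeMultC_ofRealVec]
  simp [S1r, Real.cos_neg]

/-- `conj K_∞(z) = K_∞(−z)` (the multiplier is real on the real zone). [folklore] -/
theorem conj_freeKerC (c m2 : ℝ) (z : Fin (d + 1) → ℤ) : conj (freeKerC c m2 z) = freeKerC c m2 (-z) := by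
  unfold freeKerC latticeKernel fourierBox
  rw [Complex.real_smul, Complex.real_smul, map_mul, Complex.conj_ofReal, ← integral_conj]
  congr 1
  refine setIntegral_congr_fun measurableSet_Icc fun p _ => ?_
  show conj (freeMultC c m2 (ofRealVec p) * cexp (I * phase p z)) = freeMultC c m2 (ofRealVec p) * cexp (I * phase p (-z))
  have hneg : phase p (-z) = -phase p z := by
    rw [phase_eq_ofReal, phase_eq_ofReal, ← Complex.ofReal_neg, ← Finset.sum_neg_distrib]
    congr 1; exact Finset.sum_congr rfl fun μ _ => by rw [Pi.neg_apply, Int.cast_neg, mul_neg]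
  rw [map_mul, conj_freeMultC_ofRealVec, ← Complex.exp_conj, map_mul, Complex.conj_I, phase_eq_ofReal, Complex.conj_ofReal, ← phase_eq_ofReal,
    hneg, neg_mul, mul_neg]

/-- `K_∞(−z) = K_∞(z)` (the zone and the multiplier are even). [folklore] -/
theorem freeKerC_neg (c m2 : ℝ) (z : Fin (d + 1) → ℤ) : freeKerC c m2 (-z) = freeKerC c m2 z := by
  unfold freeKerC latticeKernel fourierBox
  congr 1
  have hBZ : ∀ p : Fin (d + 1) → ℝ, -p ∈ BZ (d + 1) ↔ p ∈ BZ (d + 1) := by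
    intro p
    simp only [BZ, Set.mem_Icc, Pi.le_def, Pi.neg_apply]
    constructor <;> rintro ⟨h1, h2⟩ <;> exact ⟨fun i => by linarith [h2 i], fun i => by linarith [h1 i]⟩
  have hind : ∀ p : Fin (d + 1) → ℝ, (BZ (d + 1)).indicator (integrand (freeMultC c m2) (-z)) p
      = (BZ (d + 1)).indicator (integrand (freeMultC c m2) z) (-p) := by
    intro p
    by_cases hp : p ∈ BZ (d + 1)
    · rw [Set.indicator_of_mem hp, Set.indicator_of_mem ((hBZ p).mpr hp)]
      show freeMultC c m2 (ofRealVec p) * cexp (I * phase p (-z)) = freeMultC c m2 (ofRealVec (-p)) * cexp (I * phase (-p) z)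
      have hph : phase p (-z) = phase (-p) z := by
        rw [phase_eq_ofReal, phase_eq_ofReal]
        congr 1; exact Finset.sum_congr rfl fun μ _ => by rw [Pi.neg_apply, Pi.neg_apply, Int.cast_neg]; ring
      rw [freeMultC_ofRealVec_neg, hph]
    · rw [Set.indicator_of_notMem hp, Set.indicator_of_notMem (fun h => hp ((hBZ p).mp h))]
  have hBZm : MeasurableSet (BZ (d + 1)) := measurableSet_Icc
  rw [← integral_indicator hBZm, ← integral_indicator hBZm]
  simp_rw [hind]
  exact integral_neg_eq_self (fun p => (BZ (d + 1)).indicator (integrand (freeMultC c m2) z) p) volume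

/-- ★ `K_∞` IS REAL: `Im K_∞(z) = 0`. [folklore] -/
theorem freeKerC_im (c m2 : ℝ) (z : Fin (d + 1) → ℤ) : (freeKerC c m2 z).im = 0 := by
  have h : conj (freeKerC c m2 z) = freeKerC c m2 z := by rw [conj_freeKerC, freeKerC_neg]
  exact Complex.conj_eq_iff_im.mp h

/-- THE REAL FREE MASSIVE RESOLVENT KERNEL ON `ℤ^{d+1}`: `K_∞(z) := Re latticeKernel (1∕(m² + cΣ(2−2cos p_μ))) z`. [cite: King1986, §4 p.670 l.8–13, (2.13) p.653;
Balaban1983RegularityDecay, (2.42)–(2.43) p.584] -/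
def freeKer (c m2 : ℝ) (z : Fin (d + 1) → ℤ) : ℝ := (freeKerC c m2 z).re

/-- `(K_∞(z) : ℂ) = latticeKernel (…) z`. [folklore] -/
theorem ofReal_freeKer (c m2 : ℝ) (z : Fin (d + 1) → ℤ) : ((freeKer c m2 z : ℝ) : ℂ) = freeKerC c m2 z :=
  Complex.ext (by simp [freeKer]) (by simp [freeKer, freeKerC_im])

/-- `K_∞` is even. [folklore] -/
theorem freeKer_neg (c m2 : ℝ) (z : Fin (d + 1) → ℤ) : freeKer c m2 (-z) = freeKer c m2 z := by
  unfold freeKer; rw [freeKerC_neg]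

/-- ★★ **DECAY OF THE REAL KERNEL**: `|K_∞(z)| ≤ (2∕m²)e^{−κ_F|z|_∞}`. [cite: Balaban1983RegularityDecay, p.586 l.9–15; King1986, (4.4) p.670] -/
theorem abs_freeKer_le {c m2 : ℝ} (hc : 0 ≤ c) (hm : 0 < m2) (z : Fin (d + 1) → ℤ) :
    |freeKer c m2 z| ≤ 2 / m2 * Real.exp (-(kappaFree c m2 d * supNorm z)) := by
  have h := norm_freeKerC_le (d := d) hc hm z
  rwa [← ofReal_freeKer, Complex.norm_real, Real.norm_eq_abs] at h

/-- `K_∞ ∈ ℓ¹(ℤ^{d+1})` (real kernel). [folklore] -/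
theorem summable_freeKer {c m2 : ℝ} (hc : 0 ≤ c) (hm : 0 < m2) : Summable (freeKer (d := d) c m2) := by
  have h : Summable fun z : Fin (d + 1) → ℤ => ((freeKer c m2 z : ℝ) : ℂ) := by
    simpa only [ofReal_freeKer] using summable_freeKerC (d := d) hc hm
  exact Complex.summable_ofReal.mp h

/-- ★★ **THE GREEN EQUATION, REAL FORM**: `m²K_∞(z) + cΣ_μ(2K_∞(z) − K_∞(z+e_μ) − K_∞(z−e_μ)) = δ_{z,0}` on `ℤ^{d+1}`. [cite: King1986, (2.13) p.653, §4 p.670 l.8–13;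
Balaban1983RegularityDecay, (2.43)–(2.44) p.584] -/
theorem freeKer_green {c m2 : ℝ} (hc : 0 ≤ c) (hm : 0 < m2) (z : Fin (d + 1) → ℤ) :
    m2 * freeKer c m2 z + c * ∑ μ, (2 * freeKer c m2 z - freeKer c m2 (z + e μ) - freeKer c m2 (z - e μ)) = if z = 0 then 1 else 0 := by
  have h := freeKerC_green (d := d) hc hm z
  simp_rw [← ofReal_freeKer] at h
  apply Complex.ofReal_injective
  push_cast
  rw [h]
  split_ifs <;> simp

end Summit.QuantumFields.YangMills.BalabanUVNodes.N15KingModelRung.TorusSpectral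

end
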